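import Literature.AlgebraicGeometry.Motives.RigidTuples
import Mathlib.LinearAlgebra.BilinearForm.Orthogonal
import Mathlib.LinearAlgebra.Trace
import Mathlib.LinearAlgebra.Contraction
import HarnessLib

/-!
# The index of rigidity is even

Topic `Literature/AlgebraicGeometry/Motives`; a complement to `RigidTuples.lean`.
[Haraoka2020, Prop. 7.7]: "The index of rigidity is an even integer" (equivalently, conjugacy
classes in `GL_n` have even dimension, `d(C) = n² - dim Z(A)` "is always even", Kostov's survey of
the Deligne–Simpson problem, Notation 2).  Haraoka proves it (§7.6) from the spectral-type formula
for `dim Z(A)`; we give the basis-free proof: the bilinear form `β_A(X, Y) = tr([A, X] Y)` on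
`End V` is alternating with radical exactly the centraliser `C(A)` (non-degeneracy of the trace
pairing), and an alternating form has even rank.

## Main statements

* `exists_finrank_eq_finrank_ker_add_two_mul`: an alternating bilinear form `B` on a
  finite-dimensional vector space `W` (any characteristic) has even rank:
  `dim W = dim ker B + 2m` (split off hyperbolic planes `⟨x, y⟩`, `B(x, y) = 1`).
* `RigidTuple.exists_centralizerDim_add_two_mul_eq`: `dim C(A) + 2m = (dim V)²` for every
  `A ∈ End V`, i.e. `codim C(A)` is even.
* `RigidTuple.even_rigidityIndex`: [Haraoka2020, Prop. 7.7] — `rigidityIndex ρ` is even for every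
  tuple `ρ` in `GL(V)`, `V` finite-dimensional (no irreducibility, no `T_∞ = 1` needed).

## References
* Y. Haraoka, *Linear Differential Equations in the Complex Domain*, LNM 2271 (2020), Prop. 7.7,
  §7.6 [Haraoka2020].
* V. P. Kostov, *The Deligne–Simpson problem — a survey*, J. Algebra 281 (2004), Notation 2
  ("`d(C)` … is always even"). [folklore]
-/

noncomputable section

namespace Literature.AlgebraicGeometry.Motives

open Module

universe u w

/-! ### Alternating forms have even rank -/

section Alternating

variable {K : Type u} [Field K]

/-- The hyperbolic plane `H = ⟨x, y⟩` of an alternating form with `B x y = 1`: its elements are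
`a • x + b • y`, and `B (a x + b y) y = a`, `B (a x + b y) x = -b`. [folklore] -/
theorem isAlt_apply_pair_left {W : Type w} [AddCommGroup W] [Module K W]
    {B : LinearMap.BilinForm K W} (hB : B.IsAlt) {x y : W} (hxy : B x y = 1) (a b : K) :
    B (a • x + b • y) y = a ∧ B (a • x + b • y) x = -b := by
  have hyx : B y x = -1 := by rw [← hB.neg_eq, hxy]
  constructor
  · simp [hxy, hB.self_eq_zero]
  · simp [hyx, hB.self_eq_zero]

/-- **An alternating bilinear form has even rank**: if `B (v, v) = 0` for all `v` on a
finite-dimensional vector space `W` (any characteristic), then `dim W - dim ker B` is even.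
Proof: induction on `dim W`; if `B ≠ 0` pick `x, y` with `B(x, y) = 1`, the plane `H = ⟨x, y⟩` is
non-degenerate, `W = H ⊕ H^⊥` and `ker B = ker B|_{H^⊥}`. [folklore] -/
theorem exists_finrank_eq_finrank_ker_add_two_mul {W : Type w} [AddCommGroup W] [Module K W]
    [FiniteDimensional K W] (B : LinearMap.BilinForm K W) (hB : B.IsAlt) :
    ∃ m : ℕ, finrank K W = finrank K (LinearMap.ker B) + 2 * m := by
  suffices key : ∀ (n : ℕ) (W : Type w) [AddCommGroup W] [Module K W] [FiniteDimensional K W]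
      (B : LinearMap.BilinForm K W), B.IsAlt → finrank K W ≤ n →
      ∃ m : ℕ, finrank K W = finrank K (LinearMap.ker B) + 2 * m from
    key _ W B hB le_rfl
  intro n
  induction n with
  | zero =>
    intro W _ _ _ B _ hn
    refine ⟨0, ?_⟩
    have h0 : finrank K W = 0 := Nat.le_zero.1 hn
    have := (LinearMap.ker B).finrank_le
    omega
  | succ n ih =>
    intro W _ _ _ B hB hn
    by_cases hB0 : B = 0
    · refine ⟨0, ?_⟩
      rw [hB0, LinearMap.ker_zero, finrank_top, mul_zero, add_zero]
    -- pick `x, y` with `B x y = 1`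
    obtain ⟨x, y, hxy⟩ : ∃ x y, B x y = 1 := by
      by_contra hne
      push Not at hne
      apply hB0
      ext x' y'
      by_contra h
      exact hne x' ((B x' y')⁻¹ • y') (by rw [map_smul, smul_eq_mul, inv_mul_cancel₀ h])
    -- the hyperbolic plane `H = ⟨x, y⟩`
    have hli : LinearIndependent K ![x, y] := by
      rw [LinearIndependent.pair_iff]
      intro a b hab
      have h := isAlt_apply_pair_left hB hxy a b
      rw [hab, map_zero, LinearMap.zero_apply, LinearMap.zero_apply] at h
      exact ⟨h.1.symm, neg_eq_zero.1 h.2.symm⟩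
    set H : Submodule K W := Submodule.span K (Set.range ![x, y]) with hHdef
    have hmemH : ∀ {z : W}, z ∈ H ↔ ∃ a b : K, a • x + b • y = z := by
      intro z
      rw [hHdef, Submodule.mem_span_range_iff_exists_fun]
      constructor
      · rintro ⟨c, rfl⟩
        exact ⟨c 0, c 1, by simp [Fin.sum_univ_two]⟩
      · rintro ⟨a, b, rfl⟩
        exact ⟨![a, b], by simp [Fin.sum_univ_two]⟩
    have hxH : x ∈ H := hmemH.2 ⟨1, 0, by simp⟩
    have hyH : y ∈ H := hmemH.2 ⟨0, 1, by simp⟩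
    have hfinH : finrank K H = 2 := by rw [hHdef, finrank_span_eq_card hli]; rfl
    -- `B|_H` is non-degenerate: `B (a x + b y) y = a`, `B (a x + b y) x = -b`
    have hzero : ∀ {h : W}, h ∈ H → (∀ h' ∈ H, B h h' = 0) → h = 0 := by
      intro h hh horth
      obtain ⟨a, b, rfl⟩ := hmemH.1 hh
      have h1 := isAlt_apply_pair_left hB hxy a b
      rw [horth y hyH, horth x hxH] at h1
      rw [← h1.1, neg_eq_zero.1 h1.2.symm, zero_smul, zero_smul, add_zero]
    have hzero' : ∀ {h : W}, h ∈ H → (∀ h' ∈ H, B h' h = 0) → h = 0 := fun hh horth =>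
      hzero hh fun h' hh' => (hB.isRefl _ _ (horth h' hh'))
    have hHnd : (B.restrict H).Nondegenerate := by
      constructor
      · intro h horth
        exact Subtype.ext (hzero h.2 fun h' hh' => by simpa using horth ⟨h', hh'⟩)
      · intro h horth
        exact Subtype.ext (hzero' h.2 fun h' hh' => by simpa using horth ⟨h', hh'⟩)
    have hcompl : IsCompl H (B.orthogonal H) :=
      LinearMap.BilinForm.isCompl_orthogonal_of_restrict_nondegenerate hB.isRefl hHnd
    set U : Submodule K W := B.orthogonal H with hUdef
    have hUorth : ∀ {u : W}, u ∈ U → ∀ h ∈ H, B u h = 0 := fun hu h hh =>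
      hB.isRefl _ _ ((LinearMap.BilinForm.mem_orthogonal_iff.1 hu) h hh)
    have hUorth' : ∀ {u : W}, u ∈ U → ∀ h ∈ H, B h u = 0 := fun hu h hh =>
      (LinearMap.BilinForm.mem_orthogonal_iff.1 hu) h hh
    -- dimensions
    have hdimU : finrank K U + 2 = finrank K W := by
      have := Submodule.finrank_add_eq_of_isCompl hcompl
      omega
    -- the restriction to `U = H^⊥` is alternating with the same kernel
    have hBU : (B.restrict U).IsAlt := fun u => hB u
    have hker : LinearMap.ker B = (LinearMap.ker (B.restrict U)).map U.subtype := by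
      ext v
      constructor
      · intro hv
        rw [LinearMap.mem_ker] at hv
        obtain ⟨h, hh, u, hu, rfl⟩ := Submodule.mem_sup.1 (hcompl.sup_eq_top.symm ▸ Submodule.mem_top
          (x := v))
        have hv' : ∀ w, B (h + u) w = 0 := fun w => by rw [hv]; rfl
        have h0 : h = 0 := hzero hh fun h' hh' => by
          have := hv' h'
          rwa [map_add, LinearMap.add_apply, hUorth hu h' hh', add_zero] at this
        subst h0
        rw [zero_add] at hv' ⊢
        refine ⟨⟨u, hu⟩, ?_, rfl⟩
        rw [SetLike.mem_coe, LinearMap.mem_ker]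
        ext u'
        simpa using hv' u'
      · rintro ⟨u, hu, rfl⟩
        rw [SetLike.mem_coe, LinearMap.mem_ker] at hu
        rw [LinearMap.mem_ker]
        ext w
        obtain ⟨h, hh, u', hu', rfl⟩ := Submodule.mem_sup.1 (hcompl.sup_eq_top.symm ▸
          Submodule.mem_top (x := w))
        have := LinearMap.congr_fun hu ⟨u', hu'⟩
        simp only [LinearMap.BilinForm.restrict_apply, LinearMap.domRestrict_apply,
          LinearMap.zero_apply] at this
        rw [map_add, Submodule.coe_subtype, hUorth u.2 h hh, this, add_zero, LinearMap.zero_apply]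
    have hkerdim : finrank K (LinearMap.ker B) = finrank K (LinearMap.ker (B.restrict U)) := by
      rw [hker, Submodule.finrank_map_subtype_eq]
    obtain ⟨m, hm⟩ := ih U (B.restrict U) hBU (by omega)
    exact ⟨m + 1, by omega⟩

end Alternating

/-! ### Centralisers have even codimension; the index of rigidity is even -/

namespace RigidTuple

variable {K : Type*} [Field K] {V : Type*} [AddCommGroup V] [Module K V] [FiniteDimensional K V]

/-- Non-degeneracy of the trace pairing on `End V`: if `tr(X B) = 0` for all `X` then `B = 0`
(test against the rank-one maps `w ↦ φ(w) v`). [folklore] -/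
theorem eq_zero_of_forall_trace_mul_eq_zero {B : Module.End K V}
    (h : ∀ X : Module.End K V, LinearMap.trace K V (X * B) = 0) : B = 0 := by
  ext v
  refine (Module.forall_dual_apply_eq_zero_iff K (B v)).1 fun φ => ?_
  have key : dualTensorHom K V V (φ ⊗ₜ v) * B = dualTensorHom K V V ((φ ∘ₗ B) ⊗ₜ v) := by
    ext w
    simp [dualTensorHom_apply]
  have := h (dualTensorHom K V V (φ ⊗ₜ v))
  rw [key, LinearMap.trace_eq_contract_apply, contractLeft_apply] at this
  simpa using this

/-- **Centralisers have even codimension**: `dim C(A) + 2m = (dim V)²` for every `A ∈ End V` over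
any field — the form `β_A(X, Y) = tr((A X - X A) Y)` on `End V` is alternating (cyclicity of the
trace) with kernel `C(A)` (non-degeneracy of the trace pairing), and alternating forms have even
rank. [folklore] -/
theorem exists_centralizerDim_add_two_mul_eq (A : Module.End K V) :
    ∃ m : ℕ, centralizerDim A + 2 * m = finrank K V * finrank K V := by
  -- `β X Y = tr((A X - X A) Y)`
  let ad : Module.End K V →ₗ[K] Module.End K V :=
    LinearMap.mulLeft K A - LinearMap.mulRight K A
  let β : LinearMap.BilinForm K (Module.End K V) :=
    ((LinearMap.mul K (Module.End K V)).compr₂ (LinearMap.trace K V)) ∘ₗ ad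
  have hβ : ∀ X Y, β X Y = LinearMap.trace K V ((A * X - X * A) * Y) := fun X Y => rfl
  have halt : β.IsAlt := by
    intro X
    rw [hβ, sub_mul, map_sub, sub_eq_zero, LinearMap.trace_mul_comm, ← mul_assoc]
  have hker : LinearMap.ker β = Subalgebra.toSubmodule (Subalgebra.centralizer K {A}) := by
    ext X
    rw [LinearMap.mem_ker, Subalgebra.mem_toSubmodule, Subalgebra.mem_centralizer_iff]
    constructor
    · intro h g hg
      rw [Set.mem_singleton_iff] at hg
      rw [hg]
      have h0 : A * X - X * A = 0 := by
        refine eq_zero_of_forall_trace_mul_eq_zero fun Y => ?_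
        have := LinearMap.congr_fun h Y
        rw [hβ, LinearMap.zero_apply] at this
        rwa [LinearMap.trace_mul_comm]
      exact (sub_eq_zero.1 h0)
    · intro h
      ext Y
      rw [hβ, h A rfl, sub_self, zero_mul, map_zero, LinearMap.zero_apply]
  obtain ⟨m, hm⟩ := exists_finrank_eq_finrank_ker_add_two_mul β halt
  refine ⟨m, ?_⟩
  rw [hker, Subalgebra.finrank_toSubmodule, Module.finrank_linearMap K K V V] at hm
  unfold centralizerDim
  omega

/-- **The index of rigidity is even** ([Haraoka2020, Prop. 7.7]; "`d(C)` is always even"), for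
every tuple in `GL(V)`, `V` finite-dimensional over any field: each local term `dim C(T_i)`, and
`dim C(T_∞)`, is `≡ n² (mod 2)`, and there are `r + 1` of them against `(r - 1) n²`.
[cite: Haraoka2020, Proposition 7.7] -/
theorem even_rigidityIndex {r : ℕ} (ρ : Representation K (FreeGroup (Fin r)) V) :
    Even (rigidityIndex ρ) := by
  unfold rigidityIndex
  have hterm : ∀ B : Module.End K V, ∃ m : ℤ,
      (centralizerDim B : ℤ) = (finrank K V : ℤ) ^ 2 - 2 * m := by
    intro B
    obtain ⟨m, hm⟩ := exists_centralizerDim_add_two_mul_eq B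
    refine ⟨m, ?_⟩
    have := congrArg (Nat.cast : ℕ → ℤ) hm
    push_cast at this
    linear_combination this
  choose m hm using hterm
  rw [Finset.sum_congr rfl fun i _ => hm (ρ (FreeGroup.of i)),
    hm (ρ (MiddleConvolution.prodGenerators r)), Finset.sum_sub_distrib, Finset.sum_const,
    Finset.card_univ, Fintype.card_fin, ← Finset.mul_sum]
  refine ⟨(finrank K V : ℤ) ^ 2 - ∑ i, m (ρ (FreeGroup.of i)) -
    m (ρ (MiddleConvolution.prodGenerators r)), ?_⟩
  ring

end RigidTuple

end Literature.AlgebraicGeometry.Motives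

end
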